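import Literature.NumberTheory.EllipticCurves.Kato2004.IwasawaCohomologyZetaLift
import Literature.NumberTheory.EllipticCurves.Kato2004.IwasawaCohomologyLevelZero
import Literature.NumberTheory.EllipticCurves.Kato2004.EulerSystemValuesMember
import Literature.NumberTheory.EllipticCurves.Kato2004.AdditivePotGoodRankZeroShaUpperBound
import Literature.NumberTheory.EllipticCurves.Kato2004.HullDescentSkeletonProofs
import Literature.NumberTheory.EllipticCurves.MordellWeil
import HarnessLib

/-!
# Kato 2004 (Astérisque 295), Thm. 12.4, Thm. 12.5 (1)(2)(3), Thm. 12.6 with Lemma 13.10 (1) and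
# 13.14, §14.14 (14.14.1)–(14.14.2), Thm. 14.5 (1)(2) and Prop. 14.16 (2) with §14.8, AT KATO'S OWN
# LATTICE `T = V_{ℤ_p}(f)(1)` of an elliptic curve with a rational `p`-isogeny — the inputs of the
# rank-`0` descent at Kato's MEMBER exist on the PINNED triple (𝐇¹_Γ(T_pW_K), 𝐲, H¹(ℤ[1/p],T_pW_K))
# (ONE hypothesis structure + ONE existence fact; the zeta class is the Λ-adic class of a `ZetaBody`
# family; `𝐇²` abstract-but-constrained exactly as in `Kato2004/DivisibilityInputs.lean`)

Topic `NumberTheory/EllipticCurves`, sub-directory `Kato2004` (namespace = path). Seat `bsd-potss-rkm`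
(prover, cell `bsd-potss`, crux M = item stmt-BirchSwinnertonDyer-19196 `ReducibleKatoMember` of the
routes `KatoDescentPotSupersingular` (K9) / `KatoDescentTamePotSupersingular` (K8-t′)); this is part
P2 of the seat's realisation spec (HOME/rkm/REALISATION-SPEC-M-19196-v4.md §2/§2b, item evidence).
Template: `Kato2004/DivisibilityInputs.lean` (cell `bsd-smallim`, Kato's §17.13 inputs on the pinned
`𝐇¹_Γ`, reviewed ACCEPT): ONE hypothesis STRUCTURE whose fields are printed statements about named
modules and maps (nothing asserted), ONE named existence fact (a CONSTRUCTION fact, D-0014), no proof.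
HONEST FRAMING: the fact closes nothing by itself; its consumer
(`Summits/…/Theorems/KatoDescentPotSupersingularReducibleKatoMemberOfInputs.lean`) derives the cell's
node `O6.KatoMemberShaBoundOfReducible` (= the crux M) from it by the tree's PROVED module theory
(`Kato2004.valuation_add_padicValNat_coinvariants_le_of_hull_smul`, file `HullDescentMultiplierProofs`);
BSD is not advanced; the crux's non-CM rows remain exactly "Kato's Euler-system bound at an additive
prime with `E[p]` reducible", now conditional on THIS name instead of on three free hypothesis schemata.

## The printed statements (K. Kato, Astérisque 295 (2004); `[p. N]` = printed page; store key
`paper:doi-10-24033-ast-639`, PDF page `N − 115`; Thm. 12.4, §§8.2, 12.2, 13.1 are quoted in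
`IwasawaCohomology.lean`, (8.1.3)/Ex. 13.3/Thm. 9.7/Thm. 6.6 in `EulerSystemValues.lean`, Thm. 14.5,
Prop. 14.16, §14.8–14.10 in `AdditivePotGoodRankZeroShaUpperBound.lean` — all verbatim there)

* **§8.3 [p. 181]** "`V_{O_λ}(f)` … the `O_λ`-submodule of `V_{F_λ}(f)` generated by the image of
  `V_{k,ℤ_p}(Y₁(N))`", a `Gal(ℚ̄/ℚ)`-stable `O_λ`-lattice [p. 182].
* **Thm. 12.4 [p. 221]** "Take any `Gal(ℚ̄/ℚ)`-stable `O_λ`-lattice `T` of `V_{F_λ}`. Then: (1) `𝐇²(T)` is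
  a torsion `Λ`-module. (2) `𝐇¹(T)` is a torsion free `Λ`-module, and `𝐇¹(T) ⊗ ℚ = 𝐇¹(V_{F_λ}(f))` is a
  free `Λ ⊗ ℚ`-module of rank `1`." **(12.2.1) [p. 220]** "`𝐇¹(T)` and `𝐇²(T)` are finitely generated
  `ℤ_p[[G_∞]]`-modules."
* **Thm. 12.5 [pp. 221–222]** "(1) There exists a unique `F_λ`-linear map `V_{F_λ}(f) → 𝐇¹(V_{F_λ}(f));
  γ ↦ z_γ^{(p)}` [whose image under `exp*` at the `n`-th layer and the character `χ` is
  `(2πi)^{k−r−1} L_{{p}}(f*, χ, r) · γ^±`, `± = (−1)^{k−r−1}χ(−1)`] … (2) Let `Z(f)` be the `Λ ⊗ ℚ`-submodule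
  of `𝐇¹(V_{F_λ}(f))` generated by `z_γ^{(p)}` for all `γ ∈ V_{F_λ}(f)`. Then `𝐇¹(V_{F_λ}(f))/Z(f)` is a
  torsion `Λ ⊗ ℚ`-module. (3) Let `𝔭` be a prime ideal of `Λ` of height one which does not contain `p`.
  Then `length_{Λ_𝔭}(𝐇²(V_{F_λ}(f))_𝔭) ≤ length_{Λ_𝔭}(𝐇¹(V_{F_λ}(f))_𝔭/Z(f)_𝔭) + length_{Λ_𝔭}(𝐇²_loc(V_{F_λ}(f))_𝔭)`.
  If `𝐇²_loc(V_{F_λ}(f))_𝔭 ≠ 0`, then `f` and `𝔭` satisfy the following (12.5.1): `k = 2`, `f` is not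
  potentially of good reduction at `p` (12.7), …" — NO image hypothesis in (1)–(3); **Rem. 12.7 [p. 222]**
  potentially good reduction = crystalline over a finite extension (for `f = f_E`: `ord_p(j_E) ≥ 0`).
* **13.9 [pp. 229–230]** "`z^{(p)}_{ι(γ)} = −σ_{−1}(z_γ^{(p)})`" (so on the even components `z_γ^{(p)}`
  depends on `γ^+` only); **Lemma 13.10 (1) [p. 230]** "Let `1 ≤ j ≤ k − 1`, `a, A ∈ ℤ`, `A ≥ 1`, and
  `c, d` be integers such that `(c, 6pA) = (d, 6pN) = 1`. Then
  `(_{c,d}z^{(p)}_{p^n}(f, k, j, a(A), prime(pA)))_n = (∏_ℓ (1 − ā_ℓ ℓ^{−k}… σ_ℓ^{−1} + …σ_ℓ^{−2})) ·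
  (c²d² z_{γ₁}^{(p)} − c^u d² σ_c z_{γ₂}^{(p)} − c² d^v σ_d z_{γ₃}^{(p)} + c^u d^v σ_{cd} z_{γ₄}^{(p)})`,
  `ℓ` over the primes `≠ p` dividing `A`, `γ₁ = δ(f,j,a(A))`, `γ₂ = δ(f,j,ac(A))`, `γ₃ = δ(f,j,"a/d"(A))`,
  `γ₄ = δ(f,j,"ac/d"(A))`" — equality in `𝐇¹(V_{F_λ}(f)) ⊗_Λ Q(Λ)`; for `k = 2`, `j = 1`:
  `(u, v) = (1, 1)` ((4.2.4)); the cusp classes `δ(f,1,b(A))` are images of `H₁(X₁(N)(ℂ), {cusps}, ℤ)`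
  (§5.5, p. 156), hence lie in `V_ℤ(f) ⊂ V_{ℤ_p}(f)`.
* **Thm. 12.6 [p. 222]** "Let `T = V_{O_λ}(f)` (8.3). Let `Z` be the `Λ`-submodule of `𝐇¹(V_{O_λ}(f))`
  generated by the following elements … (1) `(_{c,d}z^{(p)}_{p^n}(f, k, j, a(A), prime(pA)))_{n≥1} ∈ 𝐇¹(T)`
  (`1 ≤ j ≤ k − 1`, `a, A ∈ ℤ`, `A ≥ 1`, `c, d ∈ ℤ`, `(c,6pA) = (d,6pN) = 1`) (2) … Then `Z ⊂ Z(f,T)`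
  and `Z(f,T)/Z` is a finite group."  **13.14 [p. 234]** "since `Z(f,T)/Z` is a finite group,
  `Z(f,T)_𝔭 ⊂ 𝐇¹(T)_𝔭` for any prime ideal `𝔭` of `Λ` of height one" — i.e. (Wuthrich 2014, Lemma 12,
  p. 395, the same two sentences) `Z(f,T) ⊂ ∩_𝔭 𝐇¹(T)_𝔭 = 𝐇¹(T)^{**}`, the REFLEXIVE HULL.
* **§14.14 [p. 243]** "Let `𝔭` be the kernel of the `O_λ`-homomorphism `Λ → O_λ` which sends `G_∞` to
  `1`. … Let `a` be a generator of `𝔭`. By the argument as in 13.8, we have an exact sequence (14.14.1)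
  `0 → 𝐇¹(T)/a𝐇¹(T) → H¹(ℤ[1/p],T) → _a𝐇²(T) → 0` and an isomorphism (14.14.2) `𝐇²(T)/a𝐇²(T) ≅
  H²(ℤ[1/p],T)`" — image-free (long exact sequence of `0 → T ⊗ Λ → T ⊗ Λ → T → 0`, `cd_p ℤ[1/p] = 2`).
* **Thm. 14.5 [p. 236]** (`r = 1`, "assume `L(f, k/2) ≠ 0` in the case `r = k/2`"): "(1) `H²(ℤ[1/p], T)`
  is finite and `rank_{O_λ}(H¹(ℤ[1/p], T)) = 1`. (2) … if `γ^± ≠ 0`, `z` is an `F_λ`-basis of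
  `H¹(ℤ[1/p], V_{F_λ}(f)(r))`"; the index `[M : z] = [M : O_L y]·[O_L : cO_L]^{-1}` for `z = c^{-1}y`
  [pp. 236–237]. **Prop. 14.16 (2) [p. 244]** "`#(S(T)) = μ^{-1} · ν · #(H⁰(ℚ, T ⊗ ℚ/ℤ)) ·
  #(H⁰(ℚ, T*(1) ⊗ ℚ/ℤ))`, `μ = [H¹(ℤ[1/p], T) : z] · #(H²(ℤ[1/p], T))^{-1}`,
  `ν = [H¹(ℚ_p, T)/H¹_f(ℚ_p, T) : z] · #(H²(ℚ_p, T))^{-1}`" — ANY stable lattice `T`, no image and no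
  reduction hypothesis; the formula is homogeneous of degree `0` in `z` (replacing `z` by `λ₀ z`,
  `λ₀ ∈ O_λ ∖ {0}`, multiplies `[H¹(ℤ[1/p],T) : z]` and `[H¹(ℚ_p,T)/H¹_f : z]` by the same `|λ₀|^{-1}`).
  **§14.8 [p. 238]** `Sel(K,T) ⊂ S(K,T)`, `S/Sel ↪ ⊕_{v∤p} H¹(F_v, H⁰(K_v^{ur}, T⊗ℚ/ℤ))/(div)`;
  **§14.9–14.10**: `#H²(ℚ_p,T) = #H⁰(ℚ_p, T*(1) ⊗ ℚ/ℤ)`, `T*(1) ≅ T` for `T = T_pE`.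

C. Wuthrich, Doc. Math. 19 (2014) [Wuthrich2014]: **Lemma 14 (p. 396)** "Let `E/ℚ` be an elliptic
curve and `p` an odd prime. If `E` admits an isogeny of degree `p` defined over `ℚ`, then the [dual of
the] fine Selmer group `R(E/ℚ_∞)` is a finitely generated `ℤ_p`-module" (no hypothesis on the reduction
at `p`; proof: the two characters of `E[p]` cut out abelian fields, Ferrero–Washington), read through
global duality as in the proof of his Prop. 15 (p. 396) / Kato §13: `μ(𝐇²(T)) = 0` (the local terms
`𝐇²_v` are finitely generated over `ℤ_p`: finitely many primes of `ℚ(ζ_{p^∞})` above each `ℓ ≠ p`, and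
`E(ℚ_p(μ_{p^∞}))[p^∞]` finite at a potentially good `p` — Imai); J. Coates–R. Sujatha, Math. Ann. 331
(2005) Thm. 3.4 / Cor. 3.5 [CoatesSujatha2005] for the same `μ = 0`.

R. Greenberg, LNM 1716 (1999) [GreenbergLNM1716]: **Prop. 4.13 and the "Cassels' theorem" paragraph**
(the cokernel of `H¹(ℚ_Σ/ℚ, E[p^∞]) → ∏_{v∈Σ} H¹(ℚ_v, E[p^∞])/Im κ_v` is dual to a quotient of
`E(ℚ)[p^∞]` when `Sel_{p^∞}(E/ℚ)` is finite) and **§3 after Lemma 3.3** (`|ker r_v| = c_v^{(p)}` for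
`v ∤ p`) — "Lemma T" of the cell: `[S(T_pE) : Sel(T_pE)] · #coker = ∏_{ℓ≠p} c_ℓ^{(p)}`, `#coker ∣ #E(ℚ)[p^∞]`.
C.-H. Kim, AJM 148 (2026) §3.2.3 display before Thm. 3.7 [Kim2022StructureSelmer] (with Kim–Nakamura
2020 Cor. 2.4): at an ADDITIVE `p ≥ 3`, `exp*_{ω_E}(H¹(ℚ_p, T_pE)) = c_p · p^{−t_p} · ℤ_p`,
`p^{t_p} = #E(ℚ_p)[p^∞] = #H²(ℚ_p, T_pE)` — verbatim the local-index step of the sibling fact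
`rankZero_padicValNat_sha_add_padicValNat_tamagawa_le_of_additive_potGood_of_imageContainsSL2` (A161″).

## The elliptic-curve specialisation and the PIN (what the structure transcribes)

`f = f_W` (`k = 2`, `F = ℚ`, `O_λ = ℤ_p`, `f* = f`), `p ≠ 2` ADDITIVE and POTENTIALLY GOOD for `W`,
`W[p]` REDUCIBLE (a rational `p`-isogeny).  KATO'S MEMBER: the curve `W_K`, `ℚ`-isogenous to `W`,
globally minimal, with `T_pW_K ≅ V_{ℤ_p}(f)(1)` as `Gal(ℚ̄/ℚ)`-lattices (exists: §8.3 + the tree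
THEOREM `exists_isIsogenous_isGloballyMinimal_tateModule_equiv_of_stableRationalLattice`, p419922;
displayed EXISTENTIALLY as in `exists_member_eulerSystem_expStar_values`, p425804 — the tree has no name
for `V_{ℤ_p}(f)`).  On `T := T_pW_K`: the `(c,d,a(A))`-classes of (8.1.3)/Ex. 13.3 form a `ZetaBody`
family (C1)–(C5) (`EulerSystemValues.lean`); for `p` odd and a cyclotomic `ℤ_p`-tower `κ` with
topological generator `γ` their `p`-power levels define a UNIQUE `𝐲 ∈ I.H` for every
`I : IwasawaH1Data W_K p κ γ` (`IwasawaH1Data.existsUnique_lift_of_zetaBody`, p431097): the element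
`N_Δ · (_{c,d}z^{(p)}_{p^{n+1}}(f,2,1,a(A),prime(pA)))_n` of `𝐇¹(T)^Δ ≅ 𝐇¹_Γ(T)` (READING of
`IwasawaCohomology.lean`: `I.H` = the `Δ`-trivial component `e₀𝐇¹(T)` over `Λ = ℤ_p⟦X⟧ = e₀ℤ_p[[G_∞]]`,
`X = γ − 1`; `N_Δ = (p−1)e₀` is a unit multiple of `e₀`).  By Lemma 13.10 (1) and 13.9,
**`𝐲 = λ · z_γ⁰`** in `𝐇¹(V)⁰` with `γ ∈ V_ℚ(f)` any element whose `γ^+` is a `ℤ_p`-basis of `T(−1)^+`,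
`z_γ⁰ := e₀ z_γ^{(p)}` and the MULTIPLIER
`λ = (p−1) · ∏_{ℓ∣A, ℓ≠p} P_ℓ(ℓ^{-1}σ_ℓ^{-1}) · (c²d² b₁ − c d² b₂ σ_c − c² d b₃ σ_d + c d b₄ σ_{cd}) ∈ Λ`,
`b_i ∈ ℤ_p` the coordinates `γ_i^+ = b_i γ^+` (`p` odd, `γ_i ∈ V_ℤ(f) ⊂ T(−1)`); its augmentation is
`λ(0) = (p−1) · ∏_{ℓ∣A,ℓ≠p} L_ℓ(E,1)^{-1} · b`, `b` the `γ^+`-coordinate of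
`γ_* = c²d²γ₁ − cd²γ₂ − c²dγ₃ + cdγ₄`, and **`λ(0) ≠ 0` for a suitable admissible `(c,d,a,A)`** (the cusp
classes `δ(f,1,b(A))`, `b ∈ ℤ`, `A ≥ 1`, are the images of the paths `{b/A, ∞}`, which generate
`H₁(X₁(N), {cusps}, ℤ)` (Manin), so their `+`-parts span `V_ℤ(f)^+ ⊗ ℤ_p ∋ γ^+`: some `δ(f,1,a(A))^+ ≠ 0`;
with `c ≡ d ≡ 1 mod A`, `c = 1 + 6pA`, `d = 1 + 6pAN`, all four `γ_i` agree and
`b = b₁ · cd(c−1)(d−1) ≠ 0`).  So the structure below is stated for a PAIR `(I, 𝐲)` and carries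
`λ` as the field `lam` with `j 𝐲 = lam • z` in the hull and `lam(0) ≠ 0`:
* `H := I.H` (PINNED), finitely generated and torsion free ((12.2.1), Thm. 12.4 (2));
* the hull `j : I.H ↪ F`, `F` finitely generated torsion free, finite cokernel (13.14 / Wuthrich L.12:
  `Z(f,T) ⊂ 𝐇¹(T)^{**}`; over the two-dimensional regular local ring `Λ` the reflexive hull of a
  finitely generated torsion-free module is free with pseudo-null = finite cokernel, Bourbaki AC VII §4.2);
* `z := z_γ⁰ ∈ F`, `z ≠ 0`, `F/Λz` torsion (Thm. 12.5 (1)(2) with 12.4 (2): rank one; `z_γ⁰ ≠ 0` since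
  `γ^+ ≠ 0` and `L(f,χ,1) ≠ 0` for almost all `χ` of `p`-power order — Thm. 13.5 (Rohrlich) / 14.5 (2));
* `H2` ABSTRACT = `𝐇²(T)⁰`: finitely generated torsion ((12.2.1), Thm. 12.4 (1));
* `A` = `H¹(ℤ[1/p], T)` PINNED to the tree's `integralH1 (tateRep W_K p) p (κ.layerSubgroup 0)` (§8.2 /
  Lemma 8.5 reading of `IwasawaCohomology.lean`; the `Λ`-structure through the augmentation `g ↦ g(0)`,
  as `Λ` acts on `H¹(ℤ[1/p], T ⊗ Λ/𝔭)` through `Λ/𝔭 = ℤ_p`), by an additive injection `toH1` with image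
  `integralH1` and `toH1 (g • a) = g(0) • toH1 a`;
* (14.14.1) `0 → I.H/X·I.H →ι A →π H2[X] → 0` exact with **`ι` PINNED: `toH1 ∘ ι ∘ mk = I.proj 0`**
  (`IwasawaH1Data.projZero`, p432102); (14.14.2) is the DEFINITION `H²(ℤ[1/p],T) := H2/X·H2` below;
* divisibility OFF `(p)` (Thm. 12.5 (3) + Rem. 12.7, image-free: on the `Δ`-trivial component and at a
  height-one `𝔮 ∌ p`, `𝐇¹(V)⁰_𝔮 = F_𝔮`, `Z(f)⁰_𝔮 = Λ_𝔮 z_γ⁰`, and `𝐇²_loc(V)_𝔮 = 0` because (12.5.1) fails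
  at a potentially good `p`): `ℓ_𝔮(H2) ≤ ℓ_𝔮(F/Λz)`;
* `μ(H2) = 0` (Wuthrich L.14 + global duality; stated only because the fact's hypotheses include
  "`W[p]` reducible" — on irreducible rows it is Coates–Sujatha's Conjecture A and is NOT claimed);
* Thm. 14.5 (1): `H2/X·H2` finite; Thm. 14.5 (2) with `λ(0) ≠ 0`: `[A : Λ·ι(𝐲̄)] ≠ 0`;
* the COUNT (Prop. 14.16 (2) at `T = T_pW_K` with the element `𝐲₀ := proj₀ 𝐲 = λ(0) · z`, by
  homogeneity; `#H⁰(ℚ,T⊗ℚ/ℤ) = #H⁰(ℚ,T*(1)⊗ℚ/ℤ) = #W_K(ℚ)[p^∞] = p^t`; §14.8 + Lemma T: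
  `#Ш[p^∞] · ∏_{ℓ≠p} c_ℓ^{(p)} ≤ #Sel(T) · [S:Sel] · #coker ≤ #S(T) · p^t`; Kim §3.2.3:
  `[H¹(ℚ_p,T)/H¹_f : 𝐲₀] = p^{ord_p exp*_ω(𝐲₀) − v_p(c_p) + t_p}`, `#H²(ℚ_p,T) = p^{t_p}`; Thm. 12.5 (1)
  transported along the isomorphism of realisations `h¹(W_K) ≅ M(f)`, `γ^+` a `ℤ_p`-basis of
  `H¹(W_K(ℂ), ℤ_p)^+ = T(−1)^+` and `ω = ω_{W_K}` Néron, so `exp*_ω(z_γ) = u · L(E,1)/Ω(W_K)`,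
  `u ∈ ℤ_p^× · {1, ½}`, `L_{{p}} = L` at an additive `p` — EXACTLY items 1–5 of the A161″ docstring with
  (12.5.2) dropped, the two `H⁰` factors `p^{2t}` kept and Cassels' cokernel `≤ p^t` kept):
  **`ord_p #Ш(W_K)[p^∞] + v_p(Tam W_K) + ord_p [A : Λ·ι(𝐲̄)] ≤ ord_p(L(W_K,1)/Ω(W_K)) + v_p(λ(0)) +
  ord_p #(H2/X·H2) + 3·ord_p #W_K(ℚ)_tors`** — the cell's Reading M3 (`KatoHull.CountReading`, kmc,
  referee-graded) with Kato's `e` (`y = p^e z_γ`) replaced by `v_p(λ(0))` for the `(c,d,a(A))`-class.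

WHAT THE ABSTRACT FIELDS DO AND DO NOT PIN (read before use; the same caveat as `DivisibilityInputs`):
`F`, `z`, `lam`, `H2`, `π` are existential inside the fact, constrained only by the listed statements;
`I.H`, `𝐲`, `A`, `ι` and every elliptic-curve quantity are pinned. The fact is WEAKER than print (it
forgets which modules `F`, `𝐇²` are) and TRUE iff Kato's genuine objects at `T = V_{ℤ_p}(f)(1)` satisfy the
fields. Its net consequence through the PROVED hull descent is the member bound
`ord_p #Ш(W_K) + v_p Tam(W_K) ≤ ord_p(L(W_K,1)/Ω(W_K)) + 3t(W_K)` (consumer file); conversely a reader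
should know that, as for every abstract-module package, witnesses for the abstract fields can be
manufactured from that consequence together with the pinned data (seat rkm spec v3 §C "collapse
test"): the content certified by review is the TRANSCRIPTION, clause by clause, of the statements above
at Kato's member — not a new theorem.

## What is NOT here

No definition of `V_{ℤ_p}(f)`, `z_γ^{(p)}`, `exp*`, `𝐇²`, `S(T)`; no image hypothesis anywhere; nothing
at `p = 2`, at a potentially multiplicative `p`, or for `W[p]` irreducible (there the sibling facts
A161/A161″ and the fine-Selmer reading apply); no claim which listed curve `W_K` is; no equality form of
the count (the cell's sharp reading M3♯ with `2t` is NOT transcribed); no Conj. 12.10; no proof; no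
`_holds` expected (size XL: Kato's Euler system, explicit reciprocity, Poitou–Tate).  No `instance`
beyond the structure's own bundled fields; no notation.

## References

* K. Kato, Astérisque 295 (2004): §8.2–8.3, Lemma 8.5 (pp. 180–184), (12.2.1) (p. 220), Thm. 12.4,
  Thm. 12.5 (pp. 221–222), Thm. 12.6, Rem. 12.7 (p. 222), 13.9, Lemma 13.10 (1), Lemma 13.11,
  13.12–13.14 (pp. 229–234), §14.1 (pp. 234–235), Thm. 14.5 and `[M : z]` (pp. 236–237), §14.8 (p. 238),
  §14.9–14.10 (pp. 239–241), §14.14 (14.14.1)–(14.14.2), Lemma 14.15, Prop. 14.16 (pp. 243–245) — read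
  2026-08-26 from the store text `paper:doi-10-24033-ast-639` pp. 106–131. [Kato2004Asterisque]
* C. Wuthrich, Doc. Math. 19 (2014) 381–402: §3.2 (p. 394), Lemma 11–12 (pp. 394–395), Lemma 14 and
  Prop. 15 (p. 396). [Wuthrich2014]
* R. Greenberg, LNM 1716 (1999): §3 (after Lemma 3.3), Prop. 4.13 and the Cassels paragraph. [GreenbergLNM1716]
* C.-H. Kim, Amer. J. Math. 148 (2026) = arXiv:2203.12159, §3.2.3 (PDF p. 16). [Kim2022StructureSelmer]
* J. Coates, R. Sujatha, Math. Ann. 331 (2005), Thm. 3.4. [CoatesSujatha2005]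
* J. H. Silverman, *AEC* III.4.12, Rem. III.4.13.2. [SilvermanAEC2009]  N. Bourbaki, *AC* VII §4 no. 2. [BourbakiAC5to7]
* Tree: `IwasawaCohomology.lean` (`IwasawaH1Data`, `integralH1`), `IwasawaCohomologyZetaLift.lean`
  (`existsUnique_lift_of_zetaBody`, `levelToLayer`), `IwasawaCohomologyLevelZero.lean` (`projZero`),
  `EulerSystemValues{,Member}.lean` (`ZetaBody`), `HullDescentMultiplierProofs.lean` (the consumer's
  algebra), `DivisibilityInputs.lean` (the template).
-/

noncomputable section

open scoped NumberField TensorProduct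
open Field IsDedekindDomain CongruenceSubgroup
open Literature.NumberTheory.GaloisRepresentations
open Literature.NumberTheory.EllipticCurves Literature.NumberTheory.EllipticCurves.ModularForms
open Literature.NumberTheory.EllipticCurves.Kato2004
open Literature.NumberTheory.EllipticCurves.Kato2004.EulerSystemValues Rat.HeightOneSpectrum
open Literature.NumberTheory.EllipticCurves.IwasawaAlgebra

namespace Literature.NumberTheory.EllipticCurves.Kato2004

section Package

variable (W : WeierstrassCurve ℚ) [W.IsElliptic] (p : ℕ) [Fact p.Prime]
  [ContinuousSMul ℤ_[p] (W.tateModule p)] (κ : ZpExtension ℚ p) (γ : absoluteGaloisGroup ℚ)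
  (I : IwasawaH1Data W p κ γ) (y : I.H)

/-- **Kato's rank-`0` descent inputs at his own lattice, on the pinned triple `(𝐇¹_Γ(T_pW), 𝐲,
H¹(ℤ[1/p], T_pW))` — hypothesis structure (a package of the printed statements; nothing asserted).**
For an elliptic curve `W/ℚ` (intended: Kato's member `W_K`, `T_pW ≅ V_{ℤ_p}(f)(1)`), a pinned Iwasawa
cohomology `I : IwasawaH1Data W p κ γ` and an element `y : I.H` (intended: the `Λ`-adic class of a
`ZetaBody` family, `IwasawaH1Data.existsUnique_lift_of_zetaBody`): the reflexive hull `j : I.H ↪ F`, Kato's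
normalised zeta element `z = z_γ⁰ ∈ F` and the multiplier `lam ∈ Λ` of Lemma 13.10 (1) with
`j y = lam • z`, `lam(0) ≠ 0`; the abstract `H2 = 𝐇²(T)⁰`; the module `A = H¹(ℤ[1/p],T)` PINNED to
`integralH1 (tateRep W p) p (κ.layerSubgroup 0)`; the exact sequence (14.14.1) with its first map pinned
to `proj₀`; and, as `Prop` fields, (12.2.1) + Thm. 12.4 (1)(2), Thm. 12.5 (2), Thm. 12.5 (3) + Rem. 12.7
off `(p)`, `μ(𝐇²(T)⁰) = 0` (Wuthrich L.14, reducible `W[p]`), Thm. 14.5 (1)(2), and the rank-`0` count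
Prop. 14.16 (2) + §14.8/Greenberg 4.13 + Kim §3.2.3 + Thm. 12.5 (1) written for the element `y`
(module docstring, "the COUNT").  The field list is exactly the hypothesis list of
`Kato2004.valuation_add_padicValNat_coinvariants_le_of_hull_smul` plus the count and the two pins.
[cite: Kato2004Asterisque, Thm. 12.4 (p. 221), Thm. 12.5 (1)–(3) (pp. 221–222), Thm. 12.6 and Rem. 12.7 (p. 222), Lemma 13.10 (1) (p. 230), 13.14 (p. 234), Thm. 14.5 (1)(2) (p. 236), §14.14 (14.14.1)–(14.14.2) (p. 243), Prop. 14.16 (2) (p. 244), §14.8 (p. 238)]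
[cite: Wuthrich2014, Lemma 12 (p. 395), Lemma 14 (p. 396)] [cite: GreenbergLNM1716, Prop. 4.13 and §3 after Lemma 3.3]
[cite: Kim2022StructureSelmer, §3.2.3 display before Thm. 3.7 (PDF p. 16)] -/
structure MemberHullInputs : Type 1 where
  /-- (12.2.1): `𝐇¹_Γ(T_pW)` is finitely generated over `Λ`. -/
  finite_H : Module.Finite (IwasawaAlgebra p) I.H
  /-- Thm. 12.4 (2): `𝐇¹_Γ(T_pW)` is torsion free. -/
  torsionFree_H : NoZeroSMulDivisors (IwasawaAlgebra p) I.H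
  /-- The reflexive hull `F = (𝐇¹_Γ)^{**}` (13.14 / Wuthrich L.12), abstract. -/
  F : Type
  [addCommGroupF : AddCommGroup F]
  [moduleF : _root_.Module (IwasawaAlgebra p) F]
  /-- `F` is finitely generated. -/
  finite_F : Module.Finite (IwasawaAlgebra p) F
  /-- `F` is torsion free. -/
  torsionFree_F : NoZeroSMulDivisors (IwasawaAlgebra p) F
  /-- The inclusion `𝐇¹_Γ ↪ (𝐇¹_Γ)^{**}`. -/
  j : I.H →ₗ[IwasawaAlgebra p] F
  /-- `j` is injective. -/
  j_injective : Function.Injective j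
  /-- The hull has finite (pseudo-null) cokernel. -/
  finite_coker : Finite (F ⧸ LinearMap.range j)
  /-- Kato's normalised zeta element `z_γ⁰` (`γ^+` a `ℤ_p`-basis of `T(−1)^+`), in the hull
  (Thm. 12.6 + 13.14). -/
  z : F
  /-- `z_γ⁰ ≠ 0` (Thm. 12.5 (1) with 13.5 / 14.5 (2)). -/
  z_ne_zero : z ≠ 0
  /-- Thm. 12.5 (2) with 12.4 (2): `F/Λz` is torsion (rank one). -/
  isTorsion_quotient : Module.IsTorsion (IwasawaAlgebra p) (F ⧸ (IwasawaAlgebra p) ∙ z)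
  /-- Lemma 13.10 (1): the multiplier `λ ∈ Λ` of the `(c,d,a(A))`-class. -/
  lam : IwasawaAlgebra p
  /-- Lemma 13.10 (1): `j y = λ • z_γ⁰`. -/
  j_y : j y = lam • z
  /-- `λ(0) ≠ 0` (the admissible `(c,d,a,A)` chosen with `γ_*^+ ≠ 0`; module docstring). -/
  lam_constantCoeff_ne_zero : PowerSeries.constantCoeff lam ≠ 0
  /-- `H2 = 𝐇²(T)⁰`, abstract. -/
  H2 : Type
  [addCommGroupH2 : AddCommGroup H2]
  [moduleH2 : _root_.Module (IwasawaAlgebra p) H2]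
  /-- (12.2.1): `𝐇²` is finitely generated. -/
  finite_H2 : Module.Finite (IwasawaAlgebra p) H2
  /-- Thm. 12.4 (1): `𝐇²` is torsion. -/
  isTorsion_H2 : Module.IsTorsion (IwasawaAlgebra p) H2
  /-- `A = H¹(ℤ[1/p], T)` as a `Λ`-module (through the augmentation), pinned by `toH1`. -/
  A : Type
  [addCommGroupA : AddCommGroup A]
  [moduleA : _root_.Module (IwasawaAlgebra p) A]
  /-- The PIN of `A`: an additive map to `H¹(ℚ, T_pW)` at the bottom layer `κ.layerSubgroup 0 = Γ_ℚ` … -/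
  toH1 : A →+ H1 (tateRep W p) (κ.layerSubgroup 0)
  /-- … injective … -/
  toH1_injective : Function.Injective toH1
  /-- … with image exactly the integral classes `H¹(ℤ[1/p], T_pW)` (§8.2, Lemma 8.5) … -/
  mem_range_toH1_iff : ∀ x : H1 (tateRep W p) (κ.layerSubgroup 0),
    x ∈ Set.range toH1 ↔ x ∈ integralH1 (tateRep W p) p (κ.layerSubgroup 0)
  /-- … and `Λ` acting on `A` through the augmentation `g ↦ g(0)` (so `X` acts as `0`). -/
  toH1_smul : ∀ (g : IwasawaAlgebra p) (a : A), toH1 (g • a) = PowerSeries.constantCoeff g • toH1 a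
  /-- (14.14.1), first map `𝐇¹_Γ/X𝐇¹_Γ → H¹(ℤ[1/p],T)`. -/
  ι : coinvariants p I.H →ₗ[IwasawaAlgebra p] A
  /-- (14.14.1), second map `H¹(ℤ[1/p],T) → 𝐇²[X]`. -/
  π : A →ₗ[IwasawaAlgebra p] invariants p H2
  /-- (14.14.1): `ι` injective. -/
  ι_injective : Function.Injective ι
  /-- (14.14.1): `π` surjective. -/
  π_surjective : Function.Surjective π
  /-- (14.14.1): exact in the middle. -/
  exact_ι_π : Function.Exact ι π
  /-- The PIN of `ι`: `ι(x mod X) = proj₀ x` in `H¹(ℚ, T_pW)` (§13.8 / (14.14.1): the map is induced by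
  `Λ → Λ/𝔭`, i.e. the projection to the bottom layer; `IwasawaH1Data.projZero`). -/
  toH1_ι : ∀ x : I.H, toH1 (ι (Submodule.Quotient.mk x)) = I.proj 0 x
  /-- Thm. 12.5 (3) with Rem. 12.7 (potentially good `p`: `𝐇²_loc = 0`), on the `Δ`-trivial component:
  `ℓ_𝔮(𝐇²) ≤ ℓ_𝔮(F/Λz_γ)` at every height-one `𝔮 ≠ (p)`. -/
  divisibility_offP : ∀ 𝔮 : PrimeSpectrum (IwasawaAlgebra p), 𝔮.asIdeal.height = 1 →
    𝔮.asIdeal ≠ augIdealP p →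
      Module.lengthAt (IwasawaAlgebra p) H2 𝔮 ≤
        Module.lengthAt (IwasawaAlgebra p) (F ⧸ (IwasawaAlgebra p) ∙ z) 𝔮
  /-- Wuthrich 2014 Lemma 14 + global duality (reducible `W[p]`, `p` odd): `μ(𝐇²(T)⁰) = 0`. -/
  mu_H2 : muInvariant p H2 = 0
  /-- Thm. 14.5 (1) with (14.14.2): `H²(ℤ[1/p],T) = 𝐇²/X𝐇²` is finite (`L(E,1) ≠ 0`). -/
  finite_coinvariants_H2 : Finite (coinvariants p H2)
  /-- Thm. 14.5 (2) with `λ(0) ≠ 0`: `y₀` is non-torsion in the rank-one `A`, `[A : Λ·ι(ȳ)] ≠ 0`. -/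
  index_ne_zero :
    Nat.card (A ⧸ (IwasawaAlgebra p) ∙ ι (Submodule.Quotient.mk y)) ≠ 0
  /-- THE COUNT (Prop. 14.16 (2) for the element `y₀ = proj₀ y` + §14.8 / Greenberg Prop. 4.13 & §3 +
  Kim §3.2.3 + Thm. 12.5 (1) with Lemma 13.10 (1); module docstring):
  `ord_p #Ш(W)[p^∞] + v_p(Tam W) + ord_p [A : Λ·ι(ȳ)] ≤ ord_p(L(W,1)/Ω(W)) + v_p(λ(0)) + ord_p #(𝐇²/X𝐇²)
  + 3·ord_p #W(ℚ)_tors`. -/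
  count : ∃ q : ℚ, W.entireLFunction 1 / (W.realPeriodRat : ℂ) = (q : ℂ) ∧
    (padicValNat p (Nat.card (AddCommGroup.primaryComponent W.sha p)) : ℤ) +
        padicValNat p W.tamagawaProduct +
        padicValNat p (Nat.card (A ⧸ (IwasawaAlgebra p) ∙ ι (Submodule.Quotient.mk y))) ≤
      padicValRat p q + ((PowerSeries.constantCoeff lam).valuation : ℤ) +
        padicValNat p (Nat.card (coinvariants p H2)) + 3 * (padicValNat p W.torsionOrder : ℤ)

attribute [instance] MemberHullInputs.addCommGroupF MemberHullInputs.moduleF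
  MemberHullInputs.addCommGroupH2 MemberHullInputs.moduleH2
  MemberHullInputs.addCommGroupA MemberHullInputs.moduleA

end Package

/-! ## The named fact: the package exists at Kato's member (Kato §§12–14 at `T = V_{ℤ_p}(f)(1)`) -/

/-- **Kato 2004, Thm. 12.4, 12.5 (1)–(3), 12.6 + Lemma 13.10 (1) + 13.14, §14.14, Thm. 14.5 (1)(2),
Prop. 14.16 (2) + §14.8 (with Greenberg Prop. 4.13 / §3, Kim §3.2.3) and Wuthrich 2014 Lemma 14, AT
KATO'S LATTICE `T = V_{ℤ_p}(f)(1)`: the rank-`0` descent inputs EXIST at Kato's member.**  For every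
globally minimal elliptic curve `W/ℚ` and every prime `p ≠ 2` of ADDITIVE (neither good nor
multiplicative), POTENTIALLY GOOD (`0 ≤ ord_p j(W)`) reduction with `W[p]` REDUCIBLE, `L(W,1) ≠ 0` and
`Ш(W/ℚ)` finite, there is a GLOBALLY MINIMAL curve `W_K/ℚ`, `ℚ`-isogenous to `W` (Kato's member:
`T_pW_K ≅ V_{ℤ_p}(f)(1)`, §8.3 + *AEC* III.4.12 — displayed existentially, as in
`exists_member_eulerSystem_expStar_values`), such that [structure facts on `T_pW_K` as instance BINDERS]
for the newform `f` of `W` and every family of complex embeddings `ι` there are witnesses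
`(κ', Λ', c, d, a, A, z, x)` with `κ' ≠ 0`, `A ≥ 1`, `(c, 6pA) = 1`, `(d, 6pN) = 1` (Ex. 13.3) satisfying
`ZetaBody W_K p f ι κ' Λ' c d a A z x` ((8.1.3)/Ex. 13.3, Prop. 8.12, Lemma 8.5, Thm. 9.7, Thm. 6.6 (1) —
the clauses of p425804 for ONE admissible datum, chosen with non-vanishing level-`0` multiplier,
module docstring), AND for every cyclotomic `ℤ_p`-tower `κ` with topological generator `γ`, every
`I : IwasawaH1Data W_K p κ γ` and THE element `𝐲 ∈ I.H` lifting the corestricted `p`-power levels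
`Cor_{ℚ(μ_{p^{n+1}})/ℚ_n}(z_{n+1,∅})` (it exists uniquely: `IwasawaH1Data.existsUnique_lift_of_zetaBody`),
the structure `MemberHullInputs W_K p κ γ I 𝐲` is inhabited (by the `Δ`-trivial components of Kato's
`𝐇¹(T)^{**}`, `z_γ^{(p)}`, the multiplier of Lemma 13.10 (1), `𝐇²(T)`, `H¹(ℤ[1/p],T)` and the maps of
(14.14.1)).  A CONSTRUCTION fact (D-0014): its content is that Kato's objects at his member satisfy the
listed printed statements; weaker than print (the identity of `F`, `𝐇²` is forgotten), never stronger;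
see the module docstring ("WHAT THE ABSTRACT FIELDS DO AND DO NOT PIN") for the honest scope.  With
`nonempty_iwasawaH1Data` and modularity it yields the cell's node `O6.KatoMemberShaBoundOfReducible`
(consumer file).  Named fact; nothing asserted; no `_holds` expected (size XL).  Flag for the referee:
`Kato-12.6-13.10-14.16(2)-member-reading-reducible` (non-verbatim steps: the `Δ`-trivial projection, the
multiplier bookkeeping `λ(0)`, Cassels' cokernel `≤ p^t`, Kim's local index, `μ = 0` from Wuthrich L.14
by duality — each a printed statement applied to `T = V_{ℤ_p}(f)(1)`).
[cite: Kato2004Asterisque, §8.3 (p. 181), Thm. 12.4 (p. 221), Thm. 12.5 (1)–(3) (pp. 221–222), Thm. 12.6 and Rem. 12.7 (p. 222), 13.9 and Lemma 13.10 (1) (pp. 229–230), 13.14 (p. 234), Thm. 14.5 (1)(2) (p. 236), §14.8 (p. 238), §14.14 (14.14.1)–(14.14.2) (p. 243), Prop. 14.16 (2) (p. 244), (8.1.3) (p. 180), Ex. 13.3 (p. 225), Prop. 8.12 (p. 186), Thm. 9.7 (p. 189), Thm. 6.6 (1) (p. 163)]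
[cite: Wuthrich2014, §3.2 and Lemma 12 (pp. 394–395), Lemma 14 (p. 396)]
[cite: GreenbergLNM1716, Prop. 4.13 and the paragraph following its proof; §3 after Lemma 3.3]
[cite: Kim2022StructureSelmer, §3.2.3 display before Thm. 3.7 (PDF p. 16)]
[cite: SilvermanAEC2009, Prop. III.4.12 with Rem. III.4.13.2] -/
def exists_memberHullInputs : Prop :=
  ∀ (W : WeierstrassCurve ℚ) [W.IsElliptic] [W.IsGloballyMinimal] (p : ℕ) [Fact p.Prime]
    (hp : p ≠ 2),
    ¬ W.HasGoodReductionAtPrime p → ¬ W.HasMultiplicativeReductionAtPrime p →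
    0 ≤ padicValRat p W.j →
    ¬ W.HasIrreducibleModPGaloisRep p →
    W.entireLFunction 1 ≠ 0 → Finite W.sha →
    ∃ (W' : WeierstrassCurve ℚ) (_ : W'.IsElliptic) (_ : W'.IsGloballyMinimal),
      WeierstrassCurve.IsIsogenous W W' ∧
      ∀ [ContinuousSMul ℤ_[p] (W'.tateModule p)] [Module.Free ℤ_[p] (W'.tateModule p)]
        [Module.Finite ℤ_[p] (W'.tateModule p)],
      ∀ {N : ℕ} [NeZero N] (f : CuspForm (Gamma0 N) 2), IsNewformOf W f →
      ∀ (ι : (m : ℕ) → (CyclotomicField m ℚ →+* ℂ)),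
      ∃ (κ' : ℝ) (Λ' : ∀ (k : ℕ) (r : Finset (HeightOneSpectrum (𝓞 ℚ))),
          H1 (tateRep W' p) (cycSubgroup p k r) →ₗ[ℤ_[p]] ℚ_[p] ⊗[ℚ] CyclotomicField (cycLevel p k r) ℚ)
        (c d a : ℤ) (A : ℕ)
        (z : ∀ (k : ℕ) (r : (cyclotomicLevelsRat p (badPlaces c d A N)).Ideals),
          H1 (tateRep W' p) ((cyclotomicLevelsRat p (badPlaces c d A N)).level k r.1))
        (x : ∀ (k : ℕ) (r : (cyclotomicLevelsRat p (badPlaces c d A N)).Ideals),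
          CyclotomicField (cycLevel p k r.1) ℚ),
        κ' ≠ 0 ∧ 0 < A ∧ Int.gcd c (6 * p * A) = 1 ∧ Int.gcd d (6 * p * N) = 1 ∧
        ZetaBody W' p f ι κ' Λ' c d a A z x ∧
        ∀ (κ : ZpExtension ℚ p) (γ : absoluteGaloisGroup ℚ) (hκ : κ.IsCyclotomic),
          κ.IsTopGenerator γ →
          ∀ (I : IwasawaH1Data W' p κ γ) (y : I.H),
            (∀ n : ℕ, I.proj n y = levelToLayer W' p hκ hp (badPlaces c d A N) n
              (z (n + 1) (cyclotomicLevelsRat p (badPlaces c d A N)).idealOne)) →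
            Nonempty (MemberHullInputs W' p κ γ I y)

-- TODO(general form): Kato's statements for every `Gal(ℚ̄/ℚ)`-stable lattice `T` of `V_{F_λ}(f)`
-- (newforms of weight `k ≥ 2` with coefficients), all `Δ`-components, `p = 2` (exact up to `×2`), the
-- member NAMED once `V_{ℤ_p}(f)` is an object of the tree, `𝐇²(T)` CONSTRUCTED (degree-2 corestriction)
-- with its Poitou–Tate sequence to the tree's `FineSelmerDualData`, and the EQUALITY of Prop. 14.16 (2).

end Literature.NumberTheory.EllipticCurves.Kato2004

end
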